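import Summits.Ventures.PercRepro.RankLevelSetLevelSevenMult4

/-!
# PercRepro — THE LEVEL-`7` CELL MAP IN THE KERNEL: THE `e`-FREE CORE AT CORANK `d` CLOSES FROM `p ≥ mult4Thr d` (p9, S4)

`proofs/SUBCLAIM-S4-p9.md` §S4.3‴. The `88` polynomial inequalities of `RankLevelSetLevelSevenArithMult4A … G` are
stated at their EXACT per-corank least thresholds (`71 89 112 … 650 … 173` for `d = 8 … 95`, the maximum `650` at
`d = 80`), so the table `mult4Thr` (those thresholds, raised to the tail's `2d + 26` at `d = 93 … 95`) and the dispatcher `level_seven_poly_mult4_cell` turn them into night-1's cell map at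
level `7` as a kernel theorem: `c025_core_seven_cell_mult4` — the `e`-free core of rank `p` and corank `d` satisfies
C-025 at `(p, 7)` whenever `p ≥ mult4Thr d` (the (Y) side uses the cap as well, `K = 7 + d`, so the tail
`16·Σ_{j ≤ 7+d} C(n, j) ≤ 2^n` needs only `p ≥ 2d + 26 ≤ mult4Thr d`). Together with `c025_core_seven_beyond_ninetyfive`
(corank `≥ 96`, `p ≥ 136`) the OPEN part of the `q = 7` window is exactly the band
`{(p, d) : 8 ≤ d ≤ 95, p < mult4Thr d} ∪ {(p, d) : d ≥ 96, p ≤ 135}` of core cells. Axioms: standard.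
-/

open scoped Matroid

namespace PercRepro

namespace ThmN

open Set

variable {α : Type}

/-- The per-corank thresholds of the level-`7` cell map, `d = 8 … 95` (a table; `1788` outside): the least threshold of the
multiplicity + T4 inequality `(P_d)`, raised to the tail's `2d + 26` at `d = 93, 94, 95` (`207 / 190 / 173 → 212 / 214 / 216`). -/
def mult4Thr (d : ℕ) : ℕ := [71, 89, 112, 136, 161, 186, 209, 230, 250, 267, 283, 298, 311, 323, 335, 345, 356, 366, 376, 386, 395, 405, 414, 423, 432, 441, 450, 459, 468, 477, 409, 379, 369, 368, 371, 377, 383, 390, 398, 405, 413, 420, 428, 435, 443, 451, 458, 466, 473, 481, 488, 495, 503, 510, 518, 525, 533, 540, 547, 555, 562, 570, 577, 584, 592, 599, 606, 613, 621, 628, 635, 643, 650, 596, 546, 501, 459, 420, 385, 353, 323, 296, 271, 248, 227, 212, 214, 216].getD (d - 8) 1788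

/-- `mult4Thr d ≥ 2d + 26` on `8 ≤ d ≤ 95` (the tail condition). -/
theorem mult4Thr_ge (d : ℕ) (hd8 : 8 ≤ d) (hd95 : d ≤ 95) : 2 * d + 26 ≤ mult4Thr d := by
  interval_cases d <;> simp [mult4Thr]

/-- **The per-corank dispatcher**: `(P_d)` at `p ≥ mult4Thr d`. -/
theorem level_seven_poly_mult4_cell (d : ℕ) (hd1 : 8 ≤ d) (hd2 : d ≤ 95) (p : ℕ) (hp : mult4Thr d ≤ p) :
    8 * ((((p + d).choose 7 : ℕ) : ℚ) +
      (∑ j ∈ Finset.range (d - 8 + 1), ((Nat.choose (min 43 (6 + d) - 7) j : ℕ) : ℚ) / ((j : ℚ) + 1)) *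
      (((d * (d + 1) / 2 : ℕ) : ℚ) * ((p + d).choose 5 : ℚ) + ((d * (d + 1) * (d + 2) / 3 : ℕ) : ℚ) * ((p + d).choose 4 : ℚ) + (((d + 4).choose 5 : ℕ) : ℚ) * ((p + d).choose 3 : ℚ) + (((d + 5).choose 6 : ℕ) : ℚ) * ((p + d).choose 2 : ℚ) + (((d + 6).choose 7 : ℕ) : ℚ) * (p + d : ℚ) + (((d + 7).choose 8 : ℕ) : ℚ)) +
      (∑ j ∈ Finset.range (d - 8 + 1), ((Nat.choose (min 87 (7 + d) - 8) j : ℕ) : ℚ) / ((j : ℚ) + 1)) *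
      (((d * (d + 1) / 2 : ℕ) : ℚ) * ((8 * d).choose 5 : ℚ) + ((d * (d + 1) * (d + 2) / 3 : ℕ) : ℚ) * ((8 * d).choose 4 : ℚ) + (((d + 4).choose 5 : ℕ) : ℚ) * ((8 * d).choose 3 : ℚ) + (((d + 5).choose 6 : ℕ) : ℚ) * ((8 * d).choose 2 : ℚ) + (((d + 6).choose 7 : ℕ) : ℚ) * (8 * d : ℚ) + (((d + 7).choose 8 : ℕ) : ℚ))) ≤
      7 * 2 ^ (d - 7) * (((p + 7).choose 7 : ℕ) : ℚ) := by
  interval_cases d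
  · exact level_seven_poly_mult4_8 p (by simp [mult4Thr] at hp; omega)
  · exact level_seven_poly_mult4_9 p (by simp [mult4Thr] at hp; omega)
  · exact level_seven_poly_mult4_10 p (by simp [mult4Thr] at hp; omega)
  · exact level_seven_poly_mult4_11 p (by simp [mult4Thr] at hp; omega)
  · exact level_seven_poly_mult4_12 p (by simp [mult4Thr] at hp; omega)
  · exact level_seven_poly_mult4_13 p (by simp [mult4Thr] at hp; omega)
  · exact level_seven_poly_mult4_14 p (by simp [mult4Thr] at hp; omega)
  · exact level_seven_poly_mult4_15 p (by simp [mult4Thr] at hp; omega)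
  · exact level_seven_poly_mult4_16 p (by simp [mult4Thr] at hp; omega)
  · exact level_seven_poly_mult4_17 p (by simp [mult4Thr] at hp; omega)
  · exact level_seven_poly_mult4_18 p (by simp [mult4Thr] at hp; omega)
  · exact level_seven_poly_mult4_19 p (by simp [mult4Thr] at hp; omega)
  · exact level_seven_poly_mult4_20 p (by simp [mult4Thr] at hp; omega)
  · exact level_seven_poly_mult4_21 p (by simp [mult4Thr] at hp; omega)
  · exact level_seven_poly_mult4_22 p (by simp [mult4Thr] at hp; omega)
  · exact level_seven_poly_mult4_23 p (by simp [mult4Thr] at hp; omega)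
  · exact level_seven_poly_mult4_24 p (by simp [mult4Thr] at hp; omega)
  · exact level_seven_poly_mult4_25 p (by simp [mult4Thr] at hp; omega)
  · exact level_seven_poly_mult4_26 p (by simp [mult4Thr] at hp; omega)
  · exact level_seven_poly_mult4_27 p (by simp [mult4Thr] at hp; omega)
  · exact level_seven_poly_mult4_28 p (by simp [mult4Thr] at hp; omega)
  · exact level_seven_poly_mult4_29 p (by simp [mult4Thr] at hp; omega)
  · exact level_seven_poly_mult4_30 p (by simp [mult4Thr] at hp; omega)
  · exact level_seven_poly_mult4_31 p (by simp [mult4Thr] at hp; omega)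
  · exact level_seven_poly_mult4_32 p (by simp [mult4Thr] at hp; omega)
  · exact level_seven_poly_mult4_33 p (by simp [mult4Thr] at hp; omega)
  · exact level_seven_poly_mult4_34 p (by simp [mult4Thr] at hp; omega)
  · exact level_seven_poly_mult4_35 p (by simp [mult4Thr] at hp; omega)
  · exact level_seven_poly_mult4_36 p (by simp [mult4Thr] at hp; omega)
  · exact level_seven_poly_mult4_37 p (by simp [mult4Thr] at hp; omega)
  · exact level_seven_poly_mult4_38 p (by simp [mult4Thr] at hp; omega)
  · exact level_seven_poly_mult4_39 p (by simp [mult4Thr] at hp; omega)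
  · exact level_seven_poly_mult4_40 p (by simp [mult4Thr] at hp; omega)
  · exact level_seven_poly_mult4_41 p (by simp [mult4Thr] at hp; omega)
  · exact level_seven_poly_mult4_42 p (by simp [mult4Thr] at hp; omega)
  · exact level_seven_poly_mult4_43 p (by simp [mult4Thr] at hp; omega)
  · exact level_seven_poly_mult4_44 p (by simp [mult4Thr] at hp; omega)
  · exact level_seven_poly_mult4_45 p (by simp [mult4Thr] at hp; omega)
  · exact level_seven_poly_mult4_46 p (by simp [mult4Thr] at hp; omega)
  · exact level_seven_poly_mult4_47 p (by simp [mult4Thr] at hp; omega)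
  · exact level_seven_poly_mult4_48 p (by simp [mult4Thr] at hp; omega)
  · exact level_seven_poly_mult4_49 p (by simp [mult4Thr] at hp; omega)
  · exact level_seven_poly_mult4_50 p (by simp [mult4Thr] at hp; omega)
  · exact level_seven_poly_mult4_51 p (by simp [mult4Thr] at hp; omega)
  · exact level_seven_poly_mult4_52 p (by simp [mult4Thr] at hp; omega)
  · exact level_seven_poly_mult4_53 p (by simp [mult4Thr] at hp; omega)
  · exact level_seven_poly_mult4_54 p (by simp [mult4Thr] at hp; omega)
  · exact level_seven_poly_mult4_55 p (by simp [mult4Thr] at hp; omega)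
  · exact level_seven_poly_mult4_56 p (by simp [mult4Thr] at hp; omega)
  · exact level_seven_poly_mult4_57 p (by simp [mult4Thr] at hp; omega)
  · exact level_seven_poly_mult4_58 p (by simp [mult4Thr] at hp; omega)
  · exact level_seven_poly_mult4_59 p (by simp [mult4Thr] at hp; omega)
  · exact level_seven_poly_mult4_60 p (by simp [mult4Thr] at hp; omega)
  · exact level_seven_poly_mult4_61 p (by simp [mult4Thr] at hp; omega)
  · exact level_seven_poly_mult4_62 p (by simp [mult4Thr] at hp; omega)
  · exact level_seven_poly_mult4_63 p (by simp [mult4Thr] at hp; omega)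
  · exact level_seven_poly_mult4_64 p (by simp [mult4Thr] at hp; omega)
  · exact level_seven_poly_mult4_65 p (by simp [mult4Thr] at hp; omega)
  · exact level_seven_poly_mult4_66 p (by simp [mult4Thr] at hp; omega)
  · exact level_seven_poly_mult4_67 p (by simp [mult4Thr] at hp; omega)
  · exact level_seven_poly_mult4_68 p (by simp [mult4Thr] at hp; omega)
  · exact level_seven_poly_mult4_69 p (by simp [mult4Thr] at hp; omega)
  · exact level_seven_poly_mult4_70 p (by simp [mult4Thr] at hp; omega)
  · exact level_seven_poly_mult4_71 p (by simp [mult4Thr] at hp; omega)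
  · exact level_seven_poly_mult4_72 p (by simp [mult4Thr] at hp; omega)
  · exact level_seven_poly_mult4_73 p (by simp [mult4Thr] at hp; omega)
  · exact level_seven_poly_mult4_74 p (by simp [mult4Thr] at hp; omega)
  · exact level_seven_poly_mult4_75 p (by simp [mult4Thr] at hp; omega)
  · exact level_seven_poly_mult4_76 p (by simp [mult4Thr] at hp; omega)
  · exact level_seven_poly_mult4_77 p (by simp [mult4Thr] at hp; omega)
  · exact level_seven_poly_mult4_78 p (by simp [mult4Thr] at hp; omega)
  · exact level_seven_poly_mult4_79 p (by simp [mult4Thr] at hp; omega)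
  · exact level_seven_poly_mult4_80 p (by simp [mult4Thr] at hp; omega)
  · exact level_seven_poly_mult4_81 p (by simp [mult4Thr] at hp; omega)
  · exact level_seven_poly_mult4_82 p (by simp [mult4Thr] at hp; omega)
  · exact level_seven_poly_mult4_83 p (by simp [mult4Thr] at hp; omega)
  · exact level_seven_poly_mult4_84 p (by simp [mult4Thr] at hp; omega)
  · exact level_seven_poly_mult4_85 p (by simp [mult4Thr] at hp; omega)
  · exact level_seven_poly_mult4_86 p (by simp [mult4Thr] at hp; omega)
  · exact level_seven_poly_mult4_87 p (by simp [mult4Thr] at hp; omega)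
  · exact level_seven_poly_mult4_88 p (by simp [mult4Thr] at hp; omega)
  · exact level_seven_poly_mult4_89 p (by simp [mult4Thr] at hp; omega)
  · exact level_seven_poly_mult4_90 p (by simp [mult4Thr] at hp; omega)
  · exact level_seven_poly_mult4_91 p (by simp [mult4Thr] at hp; omega)
  · exact level_seven_poly_mult4_92 p (by simp [mult4Thr] at hp; omega)
  · exact level_seven_poly_mult4_93 p (by simp [mult4Thr] at hp; omega)
  · exact level_seven_poly_mult4_94 p (by simp [mult4Thr] at hp; omega)
  · exact level_seven_poly_mult4_95 p (by simp [mult4Thr] at hp; omega)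

/-- **THE LEVEL-`7` CELL MAP IN THE KERNEL**: the `e`-free core of rank `p` and corank `8 ≤ d ≤ 95` satisfies C-025 at
level `7` as soon as `p ≥ mult4Thr d` (the exact per-corank threshold of the multiplicity + T4 chain; the (Y) side uses
the cap too, `K = 7 + d`, so that the tail never dominates). -/
theorem c025_core_seven_cell_mult4 (M : Matroid α) [M.Finite] (p d : ℕ) (hp : mult4Thr d ≤ p) (hd8 : 8 ≤ d)
    (hd95 : d ≤ 95) (hR : M.eRank = (p : ℕ∞)) (hn : M.E.ncard = p + d)
    (hfree : ∀ e ∈ M.E, ∃ A ⊆ M.E \ {e}, e ∉ M.closure A ∧ e ∉ M.closure ((M.E \ {e}) \ A)) :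
    RLS M p 7 := by
  classical
  have hEcard : M.ground_finite.toFinset.card = p + d := by
    rw [← Set.ncard_eq_toFinset_card _ M.ground_finite]; exact hn
  -- the core is simple: every circuit has `≥ 3` elements
  have hL : ∀ e ∈ M.E, ¬ M.IsLoop e := not_isLoop_of_free M hfree
  have hs : ∀ e ∈ M.E, ∀ f ∈ M.E, e ≠ f → M.eRk {e, f} = 2 := by
    intro e he f hf hef
    have h2 : (2 : ℕ∞) ≤ M.eRk {e, f} :=
      two_le_eRk_of_two_le_ncard_of_free M hfree (pair_subset he hf) (by rw [ncard_pair hef])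
    have h3 : M.eRk {e, f} ≤ 2 := by
      have := M.eRk_le_encard {e, f}
      rwa [encard_pair hef] at this
    exact le_antisymm h3 h2
  have hcirc : ∀ C, M.IsCircuit C → 3 ≤ C.encard := three_le_encard_of_circuit M hL hs
  have hd : M.E.encard = M.eRank + d := by
    rw [hR, ← M.ground_finite.cast_ncard_eq, hn]
    push_cast
    ring
  -- the nullity cap: every `X ⊆ E` has `|X| ≤ r(X) + d`
  have hcap : ∀ X ⊆ M.E, ∀ k : ℕ, M.eRk X ≤ k → X.ncard ≤ k + d := by
    intro X hX k hr
    have h1 := Matroid.encard_le_eRk_add_of_encard_eq hX hd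
    have h2 : X.encard ≤ (k : ℕ∞) + d := h1.trans (by gcongr)
    have hfin : X.Finite := M.ground_finite.subset hX
    rw [← hfin.cast_ncard_eq] at h2
    exact_mod_cast h2
  -- rank-`≤ 7` sets have `≤ min 87 (7 + d)` points, rank-`≤ 6` sets `≤ min 43 (6 + d)`
  have hflat : ∀ X ⊆ M.E, M.eRk X ≤ 7 → X.ncard ≤ min 87 (7 + d) :=
    fun X hX hr => le_min (Explicit.ncard_le_eightyseven_of_free M hfree X hX hr) (hcap X hX 7 hr)
  have hflat' : ∀ X ⊆ M.E, M.eRk X ≤ ((7 - 1 : ℕ) : ℕ∞) → X.ncard ≤ min 43 (6 + d) :=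
    fun X hX hr => le_min (ncard_le_fortythree_of_eRk_le_six_of_free M hfree hX (by simpa using hr))
      (hcap X hX 6 (by simpa using hr))
  -- (U)
  have hU1 := Matroid.topCount_le_ncard_compl (M := M) hR hd 7
  have hsum := Matroid.ncard_eRk_eq_ncard_le_le_sum (M := M) 7 d
  have hmul := fun m => Matroid.ncard_eRk_eq_ncard_eq_mul_le M 7 (min 87 (7 + d)) (min 43 (6 + d))
    (by norm_num) hcirc hflat hflat' hd m
  have hC1 : ∀ L ⊆ M.E, M.eRk L = 2 → L.ncard ≤ 3 :=
    fun L hL hr => ncard_le_three_of_eRk_two M hs hfree hL hr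
  have hs3 : {C | M.IsCircuit C ∧ C.ncard = 3}.ncard ≤ d * (d + 1) / 2 := by
    have hT : 2 * {C | M.IsCircuit C ∧ C.ncard = 3}.ncard ≤ d * (d + 1) := S1.two_mul_ncard_triangles_le M hC1 hd
    omega
  have hC2 : ∀ P ⊆ M.E, M.eRk P ≤ 3 → P.ncard ≤ 6 :=
    fun P hP hr => ncard_le_six_of_eRk_le_three_of_free M hfree hP hr
  have hC1' : ∀ L ⊆ M.E, M.eRk L ≤ 2 → L.ncard ≤ 3 := by
    intro L hL' hr
    have := ncard_add_one_le_two_pow_of_eRk_le M hL hfree 2 L hL' hr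
    omega
  have hs4 : {C | M.IsCircuit C ∧ C.ncard = 4}.ncard ≤ d * (d + 1) * (d + 2) / 3 := by
    have hT4 : 3 * {C : Set α | M.IsCircuit C ∧ C.ncard = 4}.ncard ≤ d * (d + 1) * (d + 2) :=
      S1.three_mul_ncard_four_circuits_le M hC1' hC2 hd
    omega
  have hs5 : {C | M.IsCircuit C ∧ C.ncard = 5}.ncard ≤ (d + 4).choose 5 :=
    Matroid.ncard_circuits_le_choose_of_encard M hd 4
  have hs6 : {C | M.IsCircuit C ∧ C.ncard = 6}.ncard ≤ (d + 5).choose 6 :=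
    Matroid.ncard_circuits_le_choose_of_encard M hd 5
  have hs7 : {C | M.IsCircuit C ∧ C.ncard = 7}.ncard ≤ (d + 6).choose 7 :=
    Matroid.ncard_circuits_le_choose_of_encard M hd 6
  have hs8 : {C | M.IsCircuit C ∧ C.ncard = 8}.ncard ≤ (d + 7).choose 8 :=
    Matroid.ncard_circuits_le_choose_of_encard M hd 7
  -- the two pair sums, bounded
  set A : ℕ := ∑ k ∈ Finset.Icc 3 (7 + 1), {C | M.IsCircuit C ∧ C.ncard = k}.ncard * M.E.ncard.choose (7 + 1 - k)
    with hAdef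
  set B : ℕ := ∑ k ∈ Finset.Icc 3 (7 + 1), {C | M.IsCircuit C ∧ C.ncard = k}.ncard * ((7 + 1) * d).choose (7 + 1 - k)
    with hBdef
  have hA : A ≤ d * (d + 1) / 2 * (p + d).choose 5 + d * (d + 1) * (d + 2) / 3 * (p + d).choose 4 +
      (d + 4).choose 5 * (p + d).choose 3 + (d + 5).choose 6 * (p + d).choose 2 + (d + 6).choose 7 * (p + d) +
      (d + 7).choose 8 := by
    rw [hAdef, Explicit.sum_Icc_three_eight, hn]
    simp only [show (7 : ℕ) + 1 - 3 = 5 from rfl, show (7 : ℕ) + 1 - 4 = 4 from rfl,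
      show (7 : ℕ) + 1 - 5 = 3 from rfl, show (7 : ℕ) + 1 - 6 = 2 from rfl,
      show (7 : ℕ) + 1 - 7 = 1 from rfl, show (7 : ℕ) + 1 - 8 = 0 from rfl, Nat.choose_one_right,
      Nat.choose_zero_right, mul_one]
    gcongr
  have hB : B ≤ d * (d + 1) / 2 * (8 * d).choose 5 + d * (d + 1) * (d + 2) / 3 * (8 * d).choose 4 +
      (d + 4).choose 5 * (8 * d).choose 3 + (d + 5).choose 6 * (8 * d).choose 2 + (d + 6).choose 7 * (8 * d) +
      (d + 7).choose 8 := by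
    rw [hBdef, Explicit.sum_Icc_three_eight]
    simp only [show (7 : ℕ) + 1 - 3 = 5 from rfl, show (7 : ℕ) + 1 - 4 = 4 from rfl,
      show (7 : ℕ) + 1 - 5 = 3 from rfl, show (7 : ℕ) + 1 - 6 = 2 from rfl,
      show (7 : ℕ) + 1 - 7 = 1 from rfl, show (7 : ℕ) + 1 - 8 = 0 from rfl, Nat.choose_one_right,
      Nat.choose_zero_right, mul_one, show (7 : ℕ) + 1 = 8 from rfl]
    gcongr
  -- the level counts in `ℚ`, weighted
  have hlevel : ∀ m ∈ Finset.Icc 8 d, ({X : Set α | X ⊆ M.E ∧ M.eRk X = 7 ∧ X.ncard = m}.ncard : ℚ) ≤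
      (((min 43 (6 + d) - 7).choose (m - 8) : ℚ) * (A : ℚ) + ((min 87 (7 + d) - 8).choose (m - 8) : ℚ) * (B : ℚ)) /
        ((m - 7 : ℕ) : ℚ) := by
    intro m hm
    rw [Finset.mem_Icc] at hm
    have hpos : (0 : ℚ) < ((m - 7 : ℕ) : ℚ) := by exact_mod_cast (by omega : 0 < m - 7)
    rw [le_div_iff₀ hpos]
    have h := hmul m
    simp only [show (7 : ℕ) + 1 = 8 from rfl] at h
    have h' : (((m - 7) * {X : Set α | X ⊆ M.E ∧ M.eRk X = 7 ∧ X.ncard = m}.ncard : ℕ) : ℚ) ≤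
        (((min 43 (6 + d) - 7).choose (m - 8) * A + (min 87 (7 + d) - 8).choose (m - 8) * B : ℕ) : ℚ) := by
      exact_mod_cast h
    push_cast at h'
    linarith
  have hre : ∑ m ∈ Finset.Icc 8 d,
      (((min 43 (6 + d) - 7).choose (m - 8) : ℚ) * (A : ℚ) + ((min 87 (7 + d) - 8).choose (m - 8) : ℚ) * (B : ℚ)) /
        ((m - 7 : ℕ) : ℚ) =
      ∑ j ∈ Finset.range (d - 7),
      (((min 43 (6 + d) - 7).choose j : ℚ) * (A : ℚ) + ((min 87 (7 + d) - 8).choose j : ℚ) * (B : ℚ)) / ((j : ℚ) + 1) := by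
    rw [show Finset.Icc 8 d = Finset.image (fun j => 8 + j) (Finset.range (d - 7)) from ?_]
    · rw [Finset.sum_image (fun a _ b _ h => by omega)]
      apply Finset.sum_congr rfl
      intro j _
      rw [show 8 + j - 8 = j by omega, show 8 + j - 7 = j + 1 by omega]
      push_cast
      ring
    · ext m
      rw [Finset.mem_Icc, Finset.mem_image]
      constructor
      · intro hm
        exact ⟨m - 8, by rw [Finset.mem_range]; omega, by omega⟩
      · rintro ⟨j, hj, rfl⟩
        rw [Finset.mem_range] at hj
        omega
  have hrange : Finset.range (d - 7) ⊆ Finset.range (d - 8 + 1) := Finset.range_mono (by omega)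
  have hUq : (Matroid.topCount M p 7 : ℚ) ≤ ((p + d).choose 7 : ℚ) +
      (((∑ j ∈ Finset.range (d - 8 + 1), ((Nat.choose (min 43 (6 + d) - 7) j : ℕ) : ℚ) / ((j : ℚ) + 1)) *
        (((d * (d + 1) / 2 : ℕ) : ℚ) * ((p + d).choose 5 : ℚ) + ((d * (d + 1) * (d + 2) / 3 : ℕ) : ℚ) * ((p + d).choose 4 : ℚ) +
          (((d + 4).choose 5 : ℕ) : ℚ) * ((p + d).choose 3 : ℚ) + (((d + 5).choose 6 : ℕ) : ℚ) * ((p + d).choose 2 : ℚ) +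
          (((d + 6).choose 7 : ℕ) : ℚ) * (p + d : ℚ) + (((d + 7).choose 8 : ℕ) : ℚ)) +
      (∑ j ∈ Finset.range (d - 8 + 1), ((Nat.choose (min 87 (7 + d) - 8) j : ℕ) : ℚ) / ((j : ℚ) + 1)) *
        (((d * (d + 1) / 2 : ℕ) : ℚ) * ((8 * d).choose 5 : ℚ) + ((d * (d + 1) * (d + 2) / 3 : ℕ) : ℚ) * ((8 * d).choose 4 : ℚ) +
          (((d + 4).choose 5 : ℕ) : ℚ) * ((8 * d).choose 3 : ℚ) + (((d + 5).choose 6 : ℕ) : ℚ) * ((8 * d).choose 2 : ℚ) +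
          (((d + 6).choose 7 : ℕ) : ℚ) * (8 * d : ℚ) + (((d + 7).choose 8 : ℕ) : ℚ)))) := by
    have h1 : (Matroid.topCount M p 7 : ℚ) ≤ ((p + d).choose 7 : ℚ) +
        ∑ m ∈ Finset.Icc 8 d, ({X : Set α | X ⊆ M.E ∧ M.eRk X = 7 ∧ X.ncard = m}.ncard : ℚ) := by
      have := hU1.trans hsum
      rw [hn] at this
      simp only [show (7 : ℕ) + 1 = 8 from rfl] at this
      exact_mod_cast this
    have hAq : (A : ℚ) ≤ (((d * (d + 1) / 2 : ℕ) : ℚ) * ((p + d).choose 5 : ℚ) + ((d * (d + 1) * (d + 2) / 3 : ℕ) : ℚ) * ((p + d).choose 4 : ℚ) +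
          (((d + 4).choose 5 : ℕ) : ℚ) * ((p + d).choose 3 : ℚ) + (((d + 5).choose 6 : ℕ) : ℚ) * ((p + d).choose 2 : ℚ) +
          (((d + 6).choose 7 : ℕ) : ℚ) * (p + d : ℚ) + (((d + 7).choose 8 : ℕ) : ℚ)) := by exact_mod_cast hA
    have hBq : (B : ℚ) ≤ (((d * (d + 1) / 2 : ℕ) : ℚ) * ((8 * d).choose 5 : ℚ) + ((d * (d + 1) * (d + 2) / 3 : ℕ) : ℚ) * ((8 * d).choose 4 : ℚ) +
          (((d + 4).choose 5 : ℕ) : ℚ) * ((8 * d).choose 3 : ℚ) + (((d + 5).choose 6 : ℕ) : ℚ) * ((8 * d).choose 2 : ℚ) +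
          (((d + 6).choose 7 : ℕ) : ℚ) * (8 * d : ℚ) + (((d + 7).choose 8 : ℕ) : ℚ)) := by exact_mod_cast hB
    have hσs0 : (0 : ℚ) ≤ ∑ j ∈ Finset.range (d - 8 + 1), ((Nat.choose (min 43 (6 + d) - 7) j : ℕ) : ℚ) / ((j : ℚ) + 1) :=
      Finset.sum_nonneg (fun j _ => by positivity)
    have hσ0 : (0 : ℚ) ≤ ∑ j ∈ Finset.range (d - 8 + 1), ((Nat.choose (min 87 (7 + d) - 8) j : ℕ) : ℚ) / ((j : ℚ) + 1) :=
      Finset.sum_nonneg (fun j _ => by positivity)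
    have h2 : ∑ m ∈ Finset.Icc 8 d, ({X : Set α | X ⊆ M.E ∧ M.eRk X = 7 ∧ X.ncard = m}.ncard : ℚ) ≤
        (∑ j ∈ Finset.range (d - 8 + 1), ((Nat.choose (min 43 (6 + d) - 7) j : ℕ) : ℚ) / ((j : ℚ) + 1)) * (A : ℚ) +
        (∑ j ∈ Finset.range (d - 8 + 1), ((Nat.choose (min 87 (7 + d) - 8) j : ℕ) : ℚ) / ((j : ℚ) + 1)) * (B : ℚ) := by
      rw [Finset.sum_mul, Finset.sum_mul, ← Finset.sum_add_distrib]
      refine (Finset.sum_le_sum hlevel).trans (hre.le.trans ?_)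
      refine Finset.sum_le_sum_of_subset_of_nonneg hrange (fun j _ _ => by positivity) |>.trans' ?_
      apply le_of_eq
      apply Finset.sum_congr rfl
      intro j _
      field_simp
    have e1 := mul_le_mul_of_nonneg_left hAq hσs0
    have e2 := mul_le_mul_of_nonneg_left hBq hσ0
    linarith
  -- (Y), with the cap: rank-`≤ 7` sets have `≤ 7 + d` points
  have hp2 : 2 * d + 26 ≤ p := by
    have := mult4Thr_ge d hd8 hd95
    omega
  have hY := Matroid.two_pow_le_midCount_add (M := M) p 7 hR
  have hA : {X : Set α | X ⊆ M.E ∧ M.eRk X ≤ 7}.ncard ≤ ∑ j ∈ Finset.range (7 + d + 1), (p + d).choose j := by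
    calc {X : Set α | X ⊆ M.E ∧ M.eRk X ≤ 7}.ncard
        ≤ {X : Set α | X ⊆ (M.ground_finite.toFinset : Set α) ∧ X.ncard ≤ 7 + d}.ncard := by
          apply ncard_le_ncard
          · intro X hX
            exact ⟨by rw [Set.Finite.coe_toFinset]; exact hX.1, (hflat X hX.1 hX.2).trans (min_le_right _ _)⟩
          · exact (Finset.finite_toSet _).finite_subsets.subset (fun X hX => hX.1)
      _ ≤ ∑ j ∈ Finset.range (7 + d + 1), M.ground_finite.toFinset.card.choose j :=
          ncard_subsets_ncard_le _ (7 + d)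
      _ = ∑ j ∈ Finset.range (7 + d + 1), (p + d).choose j := by rw [hEcard]
  have hB := Matroid.ncard_spanning_le (M := M) hd
  rw [hEcard] at hY hB
  -- the tails: `16·Σ_{j ≤ 7 + d} C(n, j) ≤ 2^n` for `n ≥ 3(7 + d) + 5`
  have hT : 16 * ∑ j ∈ Finset.range (7 + d + 1), (p + d).choose j ≤ 2 ^ (p + d) :=
    Explicit.sixteen_mul_sum_range_choose_le (7 + d) (p + d) (by omega)
  have hB' : ∑ j ∈ Finset.range (d + 1), (p + d).choose j ≤ ∑ j ∈ Finset.range (7 + d + 1), (p + d).choose j :=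
    Finset.sum_le_sum_of_subset_of_nonneg (Finset.range_mono (by omega)) (fun _ _ _ => Nat.zero_le _)
  have hAB : 8 * ({X : Set α | X ⊆ M.E ∧ M.eRk X ≤ 7}.ncard +
      {X : Set α | X ⊆ M.E ∧ M.eRk X = M.eRank}.ncard) ≤ 2 ^ (p + d) := by
    have h2 := hB.trans hB'
    omega
  -- (Φ) and the polynomial inequality
  have hΦ := phiK_le_two_pow_div p 7
  rw [Nat.choose_symm_add] at hΦ
  have hpolyq := level_seven_poly_mult4_cell d hd8 hd95 p hp
  rw [add_assoc] at hpolyq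
  -- assemble in `ℚ`
  rw [RLS_iff]
  have hYq : (2 : ℚ) ^ (p + d) ≤ (Matroid.midCount M p 7 : ℚ) +
      ({X : Set α | X ⊆ M.E ∧ M.eRk X ≤ 7}.ncard : ℚ) +
      ({X : Set α | X ⊆ M.E ∧ M.eRk X = M.eRank}.ncard : ℚ) := by exact_mod_cast hY
  have hABq : 8 * (({X : Set α | X ⊆ M.E ∧ M.eRk X ≤ 7}.ncard : ℚ) +
      ({X : Set α | X ⊆ M.E ∧ M.eRk X = M.eRank}.ncard : ℚ)) ≤ 2 ^ (p + d) := by exact_mod_cast hAB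
  have hU0 : (0 : ℚ) ≤ (Matroid.topCount M p 7 : ℚ) := Nat.cast_nonneg _
  have hd7 : 7 ≤ d := by omega
  exact level_arith (p := p) (d := d) (n := p + d) (q := 7) rfl hd7 hΦ hU0 hUq hYq hABq hpolyq


end ThmN

end PercRepro
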